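import Summits.PneNP.PneNP.Theorems.SymmetryBudgetNoHiddenOrderWindowReadout
import Summits.PneNP.PneNP.Theorems.SymmetryBudgetNoHiddenOrderPerPathCGBudgetWindow
import Summits.PneNP.PneNP.Theorems.SymmetryBudgetNoHiddenOrderBitValuationRoot

/-!
# `NoHiddenOrder` (stmt-PneNP-14781), (R2c): the function level END TO END — `GraphProgram.sound` from the root value

Route `PneNP/SymmetryBudget`.  The two shapes in which a symmetric compiler can run the certified-label scheme over the components-only
Corneil–Goldberg process on the window, each taken from the input matrix `x` to the conclusion of `GraphProgram.sound`:

* **`window_sound_block`** — process on `Fin m`, start block `W = windowSet m` with the refinement `refineIn (rootGraph x) W c₀` of any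
  start colouring `c₀` separating outside signatures (`hsig₀`; e.g. the `rankIn` colouring of the signature wires,
  `GraphReadout.hsig_refineIn_rankIn`), bit valuation at any width `n ≥ m`, generic replay decoding, admissibility at the WINDOW budget
  `AdmB (4|W| + ⌊log₂|W|⌋)` (`…PerPathCGBudgetWindow.lean`): whenever the root group `⟨W, ∅, 0⟩` has value `E`, the graph of the bit readout
  `outB W _ (rootGraph x) (refineIn …) E` is the graph of a `Bud(m,⌊log₂ m⌋)`-relabelling of `x`;
* **`window_sound_subtype`** — process on the window TYPE `↥W` with the induced graph `(rootGraph x).comap Subtype.val`, start block `univ`,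
  width `|W|`, admissibility `AdmB (4|W| + ⌊log₂|W|⌋)` in the form `Fintype.card ↥W`: the same conclusion for the readout through the
  extended colouring `extendCol`.
In both the root value EXISTS (`window_root_block`, `window_root_subtype`: `val … = some E` for some `E`), so a compiler whose output wires
read `outB` of the root group's value bits has the `sound` field of `GraphProgram m` (`…GraphSocket.lean`) outright; what remains on its
side is wire semantics, `IsSym` and the size bound (`…WindowLabels.lean` for the label index sets).
Sorry-free; supports stmt-PneNP-14781, does not close it.
-/

set_option linter.dupNamespace false -- `Summit.PneNP.PneNP.…` (D-0017 single-conjunct layout)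

namespace Summit.PneNP.PneNP.Theorems

open Finset CGBits BranchSum GraphReadout Literature.Computability.Complexity
open Summit.PneNP.PneNP.Theses.SymmetryBudget

namespace GraphReadout

variable {m : ℕ}

/-! ### Process on `Fin m` from the window -/

/-- **The root value exists** (process on `Fin m`, start block `W`, bit valuation of width `n ≥ m`, generic replay, window budget), and it is
the encoding of `(W, refineIn G W c₀)` along an enumeration of `W`. [folklore] -/
theorem window_root_block (G : SimpleGraph (Fin m)) [DecidableRel G.Adj] {W : Finset (Fin m)} (hWne : W.Nonempty) (c₀ : Fin m → ℕ)
    {n : ℕ} (hn : Fintype.card (Fin m) ≤ n) :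
    ∃ E, CertifiedLabels.val (cgProcess G) (bitValuation G n hn)
        (fun L => CertifiedLabels.replay (cgProcess G) L ⟨(W, refineIn G W c₀), hWne⟩ ∅)
        (fun L => AdmB (4 * W.card + Nat.log 2 W.card) L.X L.lam) (Fintype.card (Fin m)) ⟨W, ∅, fun _ => 0⟩ = some E ∧
      ∃ e, IsEnum n W e ∧ E = bitEnc G n (refineIn G W c₀) W.card e := by
  obtain ⟨E, hE, hgood⟩ := cg_root_good_replay_admB_card_refineIn (bitValuation G n hn) hWne c₀
  have hwf : Wf n (⟨(W, refineIn G W c₀), hWne⟩ : CGInst (Fin m)) := wf_refineIn hWne ((card_le_univ W).trans hn) c₀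
  exact ⟨E, hE, (good_iff_of_wf hwf).1 hgood⟩

/-- **`GraphProgram.sound` at the function level, process on `Fin m` from the window.** [folklore] -/
theorem window_sound_block (x : Fin m × Fin m → Bool) {W : Finset (Fin m)} (hW : W = windowSet m) (hWne : W.Nonempty) (c₀ : Fin m → ℕ)
    (hsig₀ : ∀ u ∈ W, ∀ v ∈ W, c₀ u = c₀ v → ∀ i, i ∉ W → ((rootGraph x).Adj i u ↔ (rootGraph x).Adj i v))
    {n : ℕ} (hn : Fintype.card (Fin m) ≤ n) (hWn : W.card ≤ n) {E : BVal n}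
    (hE : CertifiedLabels.val (cgProcess (rootGraph x)) (bitValuation (rootGraph x) n hn)
        (fun L => CertifiedLabels.replay (cgProcess (rootGraph x)) L ⟨(W, refineIn (rootGraph x) W c₀), hWne⟩ ∅)
        (fun L => AdmB (4 * W.card + Nat.log 2 W.card) L.X L.lam) (Fintype.card (Fin m)) ⟨W, ∅, fun _ => 0⟩ = some E) :
    ∃ ρ ∈ pointStabiliserBudget m (Nat.log 2 m),
      (SimpleGraph.fromRel fun u v => outB W hWn (rootGraph x) (refineIn (rootGraph x) W c₀) E (u, v) = true) =
        SimpleGraph.fromRel fun u v => x (ρ u, ρ v) = true := by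
  obtain ⟨E', hE', e, he, rfl⟩ := window_root_block (rootGraph x) hWne c₀ hn
  rw [hE'] at hE
  cases hE
  have hlt : ∀ u ∈ W, refineIn (rootGraph x) W c₀ u < n := fun u hu => (refineIn_lt_card c₀ hu).trans_le hWn
  exact outB_sound_matrix hW x (fun u hu v hv h i hi => hsig₀ u hu v hv (refineIn_refines c₀ hu hv h) i hi) (rowData_of_isEnum he hlt)

/-! ### Process on the window type -/

/-- **The root value exists** (process on the window TYPE `↥W`, induced graph, start block `univ`, width `|W|`, generic replay, budget in
`Fintype.card ↥W`), and it is the encoding along an enumeration of `univ`. [folklore] -/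
theorem window_root_subtype (G : SimpleGraph (Fin m)) [DecidableRel G.Adj] {W : Finset (Fin m)} (hWne : (univ : Finset ↥W).Nonempty)
    (c₀ : ↥W → ℕ) :
    ∃ E, CertifiedLabels.val (cgProcess (G.comap Subtype.val)) (bitValuation (G.comap Subtype.val) (Fintype.card ↥W) le_rfl)
        (fun L => CertifiedLabels.replay (cgProcess (G.comap Subtype.val)) L ⟨(univ, refineIn (G.comap Subtype.val) univ c₀), hWne⟩ ∅)
        (fun L => AdmB (4 * Fintype.card ↥W + Nat.log 2 (Fintype.card ↥W)) L.X L.lam) (Fintype.card ↥W) ⟨univ, ∅, fun _ => 0⟩ =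
          some E ∧
      ∃ e, IsEnum (Fintype.card ↥W) (univ : Finset ↥W) e ∧
        E = bitEnc (G.comap Subtype.val) (Fintype.card ↥W) (refineIn (G.comap Subtype.val) univ c₀) (univ : Finset ↥W).card e := by
  obtain ⟨E, hE, hgood⟩ := cg_root_good_replay_admB_refineIn (bitValuation (G.comap Subtype.val) (Fintype.card ↥W) le_rfl) hWne c₀
  have hwf : Wf (Fintype.card ↥W) (⟨(univ, refineIn (G.comap Subtype.val) univ c₀), hWne⟩ : CGInst ↥W) :=
    wf_refineIn hWne (card_univ (α := ↥W)).le c₀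
  exact ⟨E, hE, (good_iff_of_wf hwf).1 hgood⟩

/-- **`GraphProgram.sound` at the function level, process on the window type.** [folklore] -/
theorem window_sound_subtype (x : Fin m × Fin m → Bool) {W : Finset (Fin m)} (hW : W = windowSet m) (hWne : (univ : Finset ↥W).Nonempty)
    (c₀ : ↥W → ℕ) (hsig₀ : ∀ u v : ↥W, c₀ u = c₀ v → ∀ i, i ∉ W → ((rootGraph x).Adj i u ↔ (rootGraph x).Adj i v))
    (hWn : W.card ≤ Fintype.card ↥W) {E : BVal (Fintype.card ↥W)}
    (hE : CertifiedLabels.val (cgProcess ((rootGraph x).comap Subtype.val))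
        (bitValuation ((rootGraph x).comap Subtype.val) (Fintype.card ↥W) le_rfl)
        (fun L => CertifiedLabels.replay (cgProcess ((rootGraph x).comap Subtype.val)) L
          ⟨(univ, refineIn ((rootGraph x).comap Subtype.val) univ c₀), hWne⟩ ∅)
        (fun L => AdmB (4 * Fintype.card ↥W + Nat.log 2 (Fintype.card ↥W)) L.X L.lam) (Fintype.card ↥W) ⟨univ, ∅, fun _ => 0⟩ =
          some E) :
    ∃ ρ ∈ pointStabiliserBudget m (Nat.log 2 m),
      (SimpleGraph.fromRel fun u v =>
          outB W hWn (rootGraph x) (extendCol W (refineIn ((rootGraph x).comap Subtype.val) univ c₀)) E (u, v) = true) =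
        SimpleGraph.fromRel fun u v => x (ρ u, ρ v) = true := by
  obtain ⟨E', hE', e, he, rfl⟩ := window_root_subtype (rootGraph x) hWne c₀
  rw [hE'] at hE
  cases hE
  have hlt : ∀ u : ↥W, refineIn ((rootGraph x).comap Subtype.val) univ c₀ u < Fintype.card ↥W := fun u =>
    (refineIn_lt_card c₀ (mem_univ u)).trans_le (card_univ (α := ↥W)).le
  refine outB_sound_matrix hW x (fun u hu v hv h i hi => ?_) (rowData_of_isEnum_subtype he hlt)
  have h' : refineIn ((rootGraph x).comap Subtype.val) univ c₀ ⟨u, hu⟩ = refineIn ((rootGraph x).comap Subtype.val) univ c₀ ⟨v, hv⟩ := by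
    simpa [extendCol, hu, hv] using h
  exact hsig₀ ⟨u, hu⟩ ⟨v, hv⟩ (refineIn_refines c₀ (mem_univ _) (mem_univ _) h') i hi

end GraphReadout

end Summit.PneNP.PneNP.Theorems
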